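import Mathlib
import Summits.NavierStokesRegularity.NavierStokesRegularity.Theorems.TypeILiouvilleLatticeLiouville
import Summits.NavierStokesRegularity.NavierStokesRegularity.Theorems.TypeILiouvilleTypeIDoorLocalAxis

/-!
# TypeILiouvilleLatticeTypeIDoor — crux (L) stmt-NavierStokesRegularity-10661 `TypeIliouvilleL`:
# the Type-I door (stmt-4050 = registered stub `stub_typeIAncientLiouville_knssGauge`) ON THE PERIODIC STRATUM

Helper for stmt-NavierStokesRegularity-10661 (`--supports`); theorems only, no definitions, no named-fact
hypotheses; closes no item; Navier–Stokes regularity is NOT proved here (leafhand seat of the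
EulerZoomLiouville route, LAND-ONLY).

* `typeI_eq_zero_of_isLatticePeriodic` — a KNSS-gauge Type-I ancient mild field (`IsTypeIAncientMild C W`) whose
  slices are `ℤ³`-periodic vanishes identically: every backward time-shift `W(· − δ)` is in print's class P
  (`TypeILiouvilleTypeIDoorLocalAxis.typeI_shift_classP`), periodic, hence ONE constant vector by the periodic
  sieve `TypeILiouvilleLatticeMomentum.classP_const_of_isLatticePeriodic`; the Type-I bound `C/√(−t) → 0`
  (`t → −∞`) makes that vector `0`.
* `typeIAncientLiouville_onLatticePeriodic` — the same with the binders of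
  `Theses.SymmetryModuliCount.TypeIAncientLiouville` (stmt-4050) = `stub_typeIAncientLiouville_knssGauge` of the
  (L) skeleton VERBATIM (smooth, divergence-free, Oseen-kernel-mild, Type-I-in-time) plus periodicity.

With `TypeILiouvilleLatticeSieve` this closes the spatially periodic stratum for ALL THREE registered stubs of
⟨10661⟩ and for the door ⟨4050⟩. [cite: KochNadirashviliSereginSverak2009, §4 (i) p. 8 and (1.4) (arXiv:0709.3599)]
-/

noncomputable section
open MeasureTheory Filter Set Function Metric
open scoped Topology
open Literature.Analysis Literature.Analysis.FunctionSpaces Literature.Analysis.FluidPDE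
  Literature.Analysis.UnboundedOperators
set_option linter.dupNamespace false
namespace Summit.NavierStokesRegularity.NavierStokesRegularity.Theorems.TypeILiouvilleLatticeMomentum

/-- **A KNSS-gauge Type-I ancient mild field with `ℤ³`-periodic slices vanishes identically.**  Each backward
shift `W(· − δ)` (`δ > 0`) is a periodic member of print's class P, hence one constant vector `b_δ` (periodic sieve);
`‖b_δ‖ ≤ C/√(−t)` for all `t < −δ` forces `b_δ = 0`. [cite: KochNadirashviliSereginSverak2009, §4 (i) p. 8 and (1.4) (arXiv:0709.3599)] -/
theorem typeI_eq_zero_of_isLatticePeriodic {C : ℝ}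
    {W : ℝ → EuclideanSpace ℝ (Fin 3) → EuclideanSpace ℝ (Fin 3)} (hW : IsTypeIAncientMild C W)
    (hper : ∀ t < 0, Torus.IsLatticePeriodic (W t)) :
    ∀ t < 0, ∀ x, W t x = 0 := by
  -- for every `δ > 0` the shifted field is constant on `t < 0`, i.e. `W` is constant on `t < -δ`
  have hshift : ∀ δ : ℝ, 0 < δ → ∃ b : EuclideanSpace ℝ (Fin 3), ∀ t < 0, ∀ x, W (t - δ) x = b := by
    intro δ hδ
    obtain ⟨hc, hK, hm⟩ := TypeILiouvilleTypeIDoorLocalAxis.typeI_shift_classP hW hδ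
    have hsm : ContDiffOn ℝ (⊤ : ℕ∞) (uncurry W) (Iio 0 ×ˢ univ) := hW.1
    have hd : ∀ t < 0, IsWeaklyDivFree ((fun t x => W (t - δ) x) t) := by
      intro t ht
      have ht' : t - δ < 0 := by linarith
      have hslice : ContDiff ℝ (⊤ : ℕ∞) (W (t - δ)) := by
        have hι : ContDiff ℝ (⊤ : ℕ∞)
            (fun x : EuclideanSpace ℝ (Fin 3) => ((t - δ, x) : ℝ × EuclideanSpace ℝ (Fin 3))) :=
          contDiff_const.prodMk contDiff_id
        have h1 := hsm.comp_contDiff hι fun x => ⟨ht', mem_univ _⟩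
        exact h1
      exact VectorCalculus.IsDivFree.isWeaklyDivFree_holds (hW.2.1 _ ht')
        (hslice.of_le (by exact_mod_cast le_top))
    have hp : ∀ t < 0, Torus.IsLatticePeriodic ((fun t x => W (t - δ) x) t) := fun t ht =>
      hper (t - δ) (by linarith)
    exact classP_const_of_isLatticePeriodic hc hK hd hm hp
  -- the Type-I decay kills the constants
  have hlim : Tendsto (fun t : ℝ => C / Real.sqrt (-t)) atBot (𝓝 0) :=
    tendsto_const_nhds.div_atTop (Real.tendsto_sqrt_atTop.comp tendsto_neg_atBot_atTop)
  intro t ht x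
  set δ : ℝ := -t / 2 with hδdef
  have hδ : 0 < δ := by rw [hδdef]; linarith
  obtain ⟨b, hb⟩ := hshift δ hδ
  have hb' : ∀ s < -δ, ∀ y, W s y = b := by
    intro s hs y
    have := hb (s + δ) (by linarith) y
    rwa [add_sub_cancel_right] at this
  have hnorm : ∀ᶠ s in atBot, ‖b‖ ≤ C / Real.sqrt (-s) := by
    filter_upwards [eventually_lt_atBot (-δ)] with s hs
    have hs0 : s < 0 := by linarith
    rw [← hb' s hs 0]
    exact hW.norm_le hs0 0
  have hb0 : b = 0 := by
    have h1 : ‖b‖ ≤ 0 := ge_of_tendsto hlim hnorm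
    exact norm_le_zero_iff.1 h1
  have ht' : t < -δ := by rw [hδdef]; linarith
  rw [hb' t ht' x, hb0]

/-- **The Type-I door on the periodic stratum, binders VERBATIM** (`Theses.SymmetryModuliCount.TypeIAncientLiouville`,
stmt-4050 = `stub_typeIAncientLiouville_knssGauge` of the (L) skeleton): a smooth, divergence-free,
Oseen-kernel-mild, Type-I-in-time field on `(−∞,0) × ℝ³` with `ℤ³`-periodic slices vanishes identically.
[cite: KochNadirashviliSereginSverak2009, §4 (i) p. 8 and (1.4) (arXiv:0709.3599)] -/
theorem typeIAncientLiouville_onLatticePeriodic :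
    ∀ (C : ℝ) (u : ℝ → EuclideanSpace ℝ (Fin 3) → EuclideanSpace ℝ (Fin 3)),
      ContDiffOn ℝ (⊤ : ℕ∞) (Function.uncurry u) (Set.Iio 0 ×ˢ Set.univ) ∧
      (∀ t < 0, Literature.Analysis.FluidPDE.VectorCalculus.IsDivFree (u t)) ∧
      (∀ s t : ℝ, s < t → t < 0 → ∀ x,
        u t x = Literature.Analysis.FluidPDE.heatFlow (u s) (t - s) x -
          ∫ τ in Set.Ioo s t, ∫ y,
            Literature.Analysis.FluidPDE.oseenKernel (t - τ) (x - y) (u τ y) (u τ y)) ∧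
      Literature.Analysis.FluidPDE.HasTypeITimeDecay C u →
      (∀ t < 0, Torus.IsLatticePeriodic (u t)) →
      ∀ t < 0, ∀ x, u t x = 0 := by
  intro C u hu hper
  exact typeI_eq_zero_of_isLatticePeriodic (isTypeIAncientMild_iff.2 hu) hper

end Summit.NavierStokesRegularity.NavierStokesRegularity.Theorems.TypeILiouvilleLatticeMomentum

end
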